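import Summits.ResolutionOfSingularities.ResolutionOfSingularities.Theorems.PurelyInseparableDim4ResConeCInfAssembly
import Summits.ResolutionOfSingularities.ResolutionOfSingularities.Theorems.PurelyInseparableDim4ResConeTwoSlotTailL
import HarnessLib
import HarnessLib.Audit.Tags

/-!
# Purely inseparable four-folds — the slice-B END-STATE at `p = 5` MODULO THE TWO ROTATION RESIDUALS ONLY:
# K2(5) ⟺ (no `d = 2` light trap) ∧ (no binary-cone trap), given the `d = 3` T-sector no-rotation `hslotT` (K24a-R1′) and
# the `d = 4` chart-swap re-presentation `hN4` (K24b-R1) (cell `res-dim4-pi`, K2(p) lane, slice B; K27 packaging)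

[OURS · counted 0 · cell `res-dim4-pi` · K2(p) lane (holder res-dim4-p-12 g3 FINAL 2026-08-29 04:43Z: «K27c/K27-final
append when R1′/L′ and L2b/K24b-R1 land»); seat res-dim4-p-3 g4 (K27b/K24c lineage).]  Nothing here proves K2(5)
(`RidgeBudget.NoAboveFloorTrap 5 5`), `NoIsolatedTrap 5 5` or resolution of singularities in dimension ≥ 4 /
characteristic `p` — NOT proved.  AI kernel work, weaker than expert review.

Pure composition of what is in the tree on 2026-08-29 05:30Z:
* the `d = 3` two-slot killer is discharged MODULO T-SECTOR ROTATIONS — res-dim4-p-1 g4 / res-dim4-p-2 g5's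
  `no_twoSlot_tail_five_of_slotT` (`…TwoSlotTailL`, p697721: T-branch by the two-slot game, L-branch empty including
  rotations) — so K27b's `hT2` shrinks to `hslotT` («in the T-sector at `k₁`, no rotation from `k₁` on», residual R1′);
* the `d = 4` C∞ killer is discharged MODULO THE CHART-SWAP RE-PRESENTATION — res-dim4-p-3 g4's
  `noAboveFloorTrap_five_iff_residual_two_of_slotRepresentation` (`…CInfAssembly`, p698371: `hN4`, residual K24b-R1).
Hence:
* **`noAboveFloorTrap_five_iff_residual_of_slotT`** — K27b's three-conjunct sentence (no `d = 2` light trap ∧ no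
  `d = 4` light trap ∧ no binary-cone trap) modulo `hslotT` alone;
* **`noAboveFloorTrap_five_iff_residual_two_of_rotation`** — the two-conjunct END-STATE sentence
  **K2(5) ⟺ (no `d = 2` light power-cone trap) ∧ (no binary-cone trap)** modulo `hslotT` and `hN4` — both residuals
  are statements about PRESENTATIONS (rotation through a free letter), the kernel content of slice B being complete for
  non-rotating presentations.

[cite: CossartJannsenSaito2020, Thm. 3.14] bears_on: LADDER-RESOLUTION:D157-DOOR2 (res-dim4-pi · K2(p) slice B · K27
packaging modulo rotations).  Supports stmt-ResolutionOfSingularities-16155 (helper).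
-/

set_option linter.dupNamespace false -- mandated namespace of this single-conjunct summit

noncomputable section

namespace Summit.ResolutionOfSingularities.ResolutionOfSingularities.Theorems.PIDim4

namespace ResCone

open MvPolynomial
open Literature.AlgebraicGeometry.Resolution
open Literature.AlgebraicGeometry.Resolution.CentreBlowup
open Literature.AlgebraicGeometry.Resolution.Hauser2010
open Literature.AlgebraicGeometry.Resolution.HauserPerlega2019
open RidgeBudget (NoAboveFloorTrap)

/-- **K27b MODULO T-SECTOR ROTATIONS**: K2(5) ⟺ (no `d = 2` light power-cone trap) ∧ (no `d = 4` light power-cone trap)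
∧ (no binary-cone trap), given only `hslotT` — «a `d = 3` two-slot tail in the T-sector at `k₁` takes no rotation step
from `k₁` on» (res-dim4-p-1 g4's residual R1′).  `…LightResidualFive.noAboveFloorTrap_five_iff_residual_of_T2` with `hT2`
supplied by `no_twoSlot_tail_five_of_slotT`. [OURS] [cite: CossartJannsenSaito2020, Thm. 3.14] -/
theorem noAboveFloorTrap_five_iff_residual_of_slotT
    (hslotT : ∀ (K : Type) [Field K] [CharP K 5] [DecidableEq K] (c : ℕ → State K) (j : ℕ → Fin 4)
      (b : ℕ → Fin 4 → K), (∀ k, IsIsolated 5 (c k).F ∧ Step0 5 (c k) (c (k + 1))) →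
      FreeTail.IsWitnessedChain 5 c j b → (∀ e ∈ (c 0).F.support, (c 0).r ≤ e) →
      (∀ k, ordZero (c k).F ≠ (5 : ℕ)) → ∀ k₀ : ℕ, (∀ k, k₀ ≤ k → (c k).shade = ((3 : ℕ) : ℕ∞)) →
      (∀ k, k₀ ≤ k → Module.finrank K (resVertex (c k)) = 3) →
      ∀ (ν : Fin 4) (k₁ : ℕ), k₀ ≤ k₁ → (∀ k, k₁ ≤ k → 1 ≤ (c k).r ν ∧ j k ≠ ν ∧ b k ν = 0) →
      (∀ k, k₁ ≤ k → ∀ i, i ≠ ν → 1 ≤ (c k).r i →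
        ∃ t, k₀ ≤ t ∧ t < k ∧ j t = i ∧ ∀ m, t < m → m < k → j m ≠ i ∧ b m i = 0) →
      (∀ ℓ : Fin 4 → K, (∀ w, w ∈ resVertex (c k₁) ↔ dotProduct ℓ w = 0) →
        ∀ i, (c k₁).r i = 0 → ℓ i ≠ 0) → ∀ k, k₁ ≤ k → 1 ≤ (c k).r (j k)) :
    NoAboveFloorTrap 5 5 ↔ ∀ (K : Type) [Field K] [CharP K 5] [DecidableEq K],
      (¬ ∃ (c : ℕ → State K) (j : ℕ → Fin 4) (b : ℕ → Fin 4 → K),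
          (∀ e' ∈ (c 0).F.support, (c 0).r ≤ e') ∧ FreeTail.IsWitnessedChain 5 c j b ∧
          (∀ k, IsIsolated 5 (c k).F ∧ Step0 5 (c k) (c (k + 1)) ∧ ordZero (c k).F ≠ (5 : ℕ) ∧
            (c k).shade = ((2 : ℕ) : ℕ∞) ∧ Module.finrank K (resVertex (c k)) = 3) ∧
          ∀ N, ∃ k, N ≤ k ∧ FreeTail.IsSatellite j b k ∧
            ordZero (c k).F = (6 : ℕ) ∧ ordZero (c (k + 1)).F = (6 : ℕ)) ∧
      (¬ ∃ (c : ℕ → State K) (j : ℕ → Fin 4) (b : ℕ → Fin 4 → K),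
          (∀ e' ∈ (c 0).F.support, (c 0).r ≤ e') ∧ FreeTail.IsWitnessedChain 5 c j b ∧
          (∀ k, IsIsolated 5 (c k).F ∧ Step0 5 (c k) (c (k + 1)) ∧ ordZero (c k).F ≠ (5 : ℕ) ∧
            (c k).shade = ((4 : ℕ) : ℕ∞) ∧ Module.finrank K (resVertex (c k)) = 3) ∧
          ∀ N, ∃ k, N ≤ k ∧ FreeTail.IsSatellite j b k ∧
            ordZero (c k).F = (6 : ℕ) ∧ ordZero (c (k + 1)).F = (6 : ℕ)) ∧
      (¬ ∃ (c : ℕ → State K) (d : ℕ), 2 ≤ d ∧ d ≤ 4 ∧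
          (∀ e' ∈ (c 0).F.support, (c 0).r ≤ e') ∧
          ∀ k, IsIsolated 5 (c k).F ∧ Step0 5 (c k) (c (k + 1)) ∧ ordZero (c k).F ≠ (5 : ℕ) ∧
            (c k).shade = (d : ℕ∞) ∧ Module.finrank K (resVertex (c k)) = 2) :=
  noAboveFloorTrap_five_iff_residual_of_T2 fun K _ _ _ c j b hc hw hr0 hfloor k₀ hshade he3 ν k₁ hk₁ hidle hborn =>
    no_twoSlot_tail_five_of_slotT hc hw hr0 hfloor hshade he3 hk₁ hidle hborn
      (hslotT K c j b hc hw hr0 hfloor k₀ hshade he3 ν k₁ hk₁ hidle hborn)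

/-- **THE SLICE-B END-STATE AT `p = 5` MODULO THE TWO ROTATION RESIDUALS**: K2(5) ⟺ (no `d = 2` light power-cone
trap) ∧ (no binary-cone trap), given `hslotT` (the `d = 3` T-sector no-rotation residual R1′, res-dim4-p-1 g4) and `hN4`
(the `d = 4` chart-swap re-presentation K24b-R1: every chain of the C∞ block admits a presentation satisfying the block
and taking no rotation step from its `k₁` on).  `…CInfAssembly.noAboveFloorTrap_five_iff_residual_two_of_slotRepresentation`
with `hT2` supplied by `no_twoSlot_tail_five_of_slotT`. [OURS] [cite: CossartJannsenSaito2020, Thm. 3.14] -/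
theorem noAboveFloorTrap_five_iff_residual_two_of_rotation
    (hslotT : ∀ (K : Type) [Field K] [CharP K 5] [DecidableEq K] (c : ℕ → State K) (j : ℕ → Fin 4)
      (b : ℕ → Fin 4 → K), (∀ k, IsIsolated 5 (c k).F ∧ Step0 5 (c k) (c (k + 1))) →
      FreeTail.IsWitnessedChain 5 c j b → (∀ e ∈ (c 0).F.support, (c 0).r ≤ e) →
      (∀ k, ordZero (c k).F ≠ (5 : ℕ)) → ∀ k₀ : ℕ, (∀ k, k₀ ≤ k → (c k).shade = ((3 : ℕ) : ℕ∞)) →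
      (∀ k, k₀ ≤ k → Module.finrank K (resVertex (c k)) = 3) →
      ∀ (ν : Fin 4) (k₁ : ℕ), k₀ ≤ k₁ → (∀ k, k₁ ≤ k → 1 ≤ (c k).r ν ∧ j k ≠ ν ∧ b k ν = 0) →
      (∀ k, k₁ ≤ k → ∀ i, i ≠ ν → 1 ≤ (c k).r i →
        ∃ t, k₀ ≤ t ∧ t < k ∧ j t = i ∧ ∀ m, t < m → m < k → j m ≠ i ∧ b m i = 0) →
      (∀ ℓ : Fin 4 → K, (∀ w, w ∈ resVertex (c k₁) ↔ dotProduct ℓ w = 0) →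
        ∀ i, (c k₁).r i = 0 → ℓ i ≠ 0) → ∀ k, k₁ ≤ k → 1 ≤ (c k).r (j k))
    (hN4 : ∀ (K : Type) [Field K] [CharP K 5] [DecidableEq K] (c : ℕ → State K) (j : ℕ → Fin 4)
      (b : ℕ → Fin 4 → K), (∀ k, IsIsolated 5 (c k).F ∧ Step0 5 (c k) (c (k + 1))) →
      FreeTail.IsWitnessedChain 5 c j b → (∀ e ∈ (c 0).F.support, (c 0).r ≤ e) →
      (∀ k, ordZero (c k).F ≠ (5 : ℕ)) → ∀ k₀ : ℕ, (∀ k, k₀ ≤ k → (c k).shade = ((4 : ℕ) : ℕ∞)) →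
      (∀ k, k₀ ≤ k → Module.finrank K (resVertex (c k)) = 3) →
      ∀ k₁ : ℕ, k₀ ≤ k₁ → (∀ k, k₀ ≤ k → (∀ i, (c k).r i ≤ 1) ∧ (c k).r.degree = 2) →
      (∀ k, k₁ ≤ k → ∀ i, 1 ≤ (c k).r i →
        ∃ t, k₀ ≤ t ∧ t < k ∧ j t = i ∧ ∀ m, t < m → m < k → j m ≠ i ∧ b m i = 0) →
      ∃ (c' : ℕ → State K) (j' : ℕ → Fin 4) (b' : ℕ → Fin 4 → K) (k₀' k₁' : ℕ),
        (∀ k, IsIsolated 5 (c' k).F ∧ Step0 5 (c' k) (c' (k + 1))) ∧ FreeTail.IsWitnessedChain 5 c' j' b' ∧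
        (∀ e ∈ (c' 0).F.support, (c' 0).r ≤ e) ∧ (∀ k, ordZero (c' k).F ≠ (5 : ℕ)) ∧
        (∀ k, k₀' ≤ k → (c' k).shade = ((4 : ℕ) : ℕ∞)) ∧
        (∀ k, k₀' ≤ k → Module.finrank K (resVertex (c' k)) = 3) ∧ k₀' ≤ k₁' ∧
        (∀ k, k₀' ≤ k → (∀ i, (c' k).r i ≤ 1) ∧ (c' k).r.degree = 2) ∧
        (∀ k, k₁' ≤ k → ∀ i, 1 ≤ (c' k).r i →
          ∃ t, k₀' ≤ t ∧ t < k ∧ j' t = i ∧ ∀ m, t < m → m < k → j' m ≠ i ∧ b' m i = 0) ∧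
        (∀ k, k₁' ≤ k → 1 ≤ (c' k).r (j' k))) :
    NoAboveFloorTrap 5 5 ↔ ∀ (K : Type) [Field K] [CharP K 5] [DecidableEq K],
      (¬ ∃ (c : ℕ → State K) (j : ℕ → Fin 4) (b : ℕ → Fin 4 → K),
          (∀ e' ∈ (c 0).F.support, (c 0).r ≤ e') ∧ FreeTail.IsWitnessedChain 5 c j b ∧
          (∀ k, IsIsolated 5 (c k).F ∧ Step0 5 (c k) (c (k + 1)) ∧ ordZero (c k).F ≠ (5 : ℕ) ∧
            (c k).shade = ((2 : ℕ) : ℕ∞) ∧ Module.finrank K (resVertex (c k)) = 3) ∧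
          ∀ N, ∃ k, N ≤ k ∧ FreeTail.IsSatellite j b k ∧
            ordZero (c k).F = (6 : ℕ) ∧ ordZero (c (k + 1)).F = (6 : ℕ)) ∧
      (¬ ∃ (c : ℕ → State K) (d : ℕ), 2 ≤ d ∧ d ≤ 4 ∧
          (∀ e' ∈ (c 0).F.support, (c 0).r ≤ e') ∧
          ∀ k, IsIsolated 5 (c k).F ∧ Step0 5 (c k) (c (k + 1)) ∧ ordZero (c k).F ≠ (5 : ℕ) ∧
            (c k).shade = (d : ℕ∞) ∧ Module.finrank K (resVertex (c k)) = 2) :=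
  noAboveFloorTrap_five_iff_residual_two_of_slotRepresentation
    (fun K _ _ _ c j b hc hw hr0 hfloor k₀ hshade he3 ν k₁ hk₁ hidle hborn =>
      no_twoSlot_tail_five_of_slotT hc hw hr0 hfloor hshade he3 hk₁ hidle hborn
        (hslotT K c j b hc hw hr0 hfloor k₀ hshade he3 ν k₁ hk₁ hidle hborn))
    hN4

end ResCone

end Summit.ResolutionOfSingularities.ResolutionOfSingularities.Theorems.PIDim4

end
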